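import Summits.CriticalPhenomena.SAWScalingLimit.Theorems.SAWRenewalTightnessConfinementPositivityPinnedAssembly
import Summits.CriticalPhenomena.SAWScalingLimit.Theorems.SAWRenewalTightnessConfinementPositivityPinnedDenominator
import Summits.CriticalPhenomena.SAWScalingLimit.Theorems.SAWRenewalTightnessConfinementPositivityPinnedNumerator
import Summits.CriticalPhenomena.SAWScalingLimit.Theorems.SAWRenewalTightnessConfinementPositivityUnpinnedSlabTube
import Summits.CriticalPhenomena.SAWScalingLimit.Theorems.SAWRenewalTightnessConfinementPositivityExtentOfExpTail
import HarnessLib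

/-!
# Crux `ConfinementPositivity` (stmt-CriticalPhenomena-17587), line `Sketch`: the lattice core assembled —
# two-sided slab RSW for the critical ℤ² SAW from five primitives of Kesten's irreducible-bridge measure

The composite of the line's LANDED lattice stubs (lead skeleton v4.1, `Cruxes/ConfinementPositivity/Lines/Sketch.lean`,
`LeadAnalysis-c2.md` §1), recorded as ONE conditional theorem with its hypotheses written out, so that it can be cited
(and its hypotheses discharged) by name:

`(UAT-exp ∧ AR) → (S ∧ USP ∧ LR) → SlabTubeConfinement'`.

* UAT-exp: exponential conditional tail of the vertical extent of one irreducible bridge given its span;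
  AR: its end-height atoms are `≤ C/s`;  S `SmallPiecesFloor` / USP `SmallPiecesCeiling`: among Kesten chains of a given total
  span, those with all pieces small carry at least `q(a,b)` / at most `C/K²` of the mass;  LR `HeightLocalRichness`: end-height
  atoms `≥ c/s` at every `|h| ≤ As` with overshoot `≤ s/D`, spans `≥ s₀(A,D)`.  All five are OPEN (RSW-type statements about the
  critical SAW; no tool in print); none is asserted here.
* Conclusion `SlabTubeConfinement'`: for every aspect bound `α` some `c(α) > 0` makes the `x_c`-mass of self-avoiding walks
  `(0,y₀) → (L,y₁)` in the slab `0 ≤ x ≤ L` staying in `|y| ≤ W` at least `c(α)` times the mass of those staying in `|y| ≤ V`,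
  whenever `1 ≤ W ≤ V`, `L ≤ αW`, `W ≤ α(L+1)`, `|y₀|, |y₁| ≤ W/2` (partial sums: `∀ N ∃ N'`).

Proof: `stub_pinnedAssembly (stub_pinnedDenominator AR USP) (stub_pinnedNumerator (stub_unpinnedSlabTube
(stub_extentSecondMoment_of_expTail UAT-exp) S) LR USP)` — files `…ExtentOfExpTail` (p154815), `…UnpinnedSlabTube` (p151705),
`…PinnedDenominator` (p160861), `…PinnedNumerator` (p163106), `…PinnedAssembly` (p163906).  No new definitions.
-/

noncomputable section

open scoped BigOperators ENNReal
open Classical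
open Literature.Probability.LatticeModels
open Literature.Probability.RandomPlanarGeometry Literature.Probability.RandomPlanarGeometry.SAW

namespace Summit.CriticalPhenomena.SAWScalingLimit.Theorems

/-- **Two-sided slab RSW for the critical ℤ² SAW, conditionally on five primitives of Kesten's irreducible-bridge measure**
(registered helper `slabRSW_of_kestenPrimitives` of crux stmt-CriticalPhenomena-17587; the composite of the landed stubs UE, B′u,
Den, Num, Asm of line `Sketch`). -/
theorem slabRSW_of_kestenPrimitives :
    ((∃ C : ℝ, 0 < C ∧ ∀ s t : ℕ, 1 ≤ s → 1 ≤ t →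
      (∑' w : {w : List Step // IsIrrBridge w},
          {w : {w : List Step // IsIrrBridge w} | xEnd w.1 = s ∧
              t * s ≤ (Finset.range (w.1.length + 1)).sup fun i => (traj w.1 i 1).natAbs}.indicator
            (fun w => criticalFugacity ^ w.1.length) w) ≤
        C * Real.exp (-(t : ℝ) / C) * ∑' w : {w : List Step // IsIrrBridge w},
          {w : {w : List Step // IsIrrBridge w} | xEnd w.1 = s}.indicator
            (fun w => criticalFugacity ^ w.1.length) w) ∧
    (∃ C : ℝ, 0 < C ∧ ∀ s : ℕ, 1 ≤ s → ∀ h : ℤ,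
      (∑' w : {w : List Step // IsIrrBridge w},
          {w : {w : List Step // IsIrrBridge w} | xEnd w.1 = s ∧ wEnd w.1 1 = h}.indicator
            (fun w => criticalFugacity ^ w.1.length) w) ≤
        C / s * ∑' w : {w : List Step // IsIrrBridge w},
          {w : {w : List Step // IsIrrBridge w} | xEnd w.1 = s}.indicator
            (fun w => criticalFugacity ^ w.1.length) w)) →
    ((∀ a b : ℕ, 1 ≤ a → 1 ≤ b → ∃ q : ℝ, 0 < q ∧ ∀ W L : ℕ, b ≤ W → L ≤ a * W →
      ENNReal.ofReal q *
          (∑' l : {l : List (List Step) // (∀ w ∈ l, IsIrrBridge w) ∧ (l.map xEnd).sum = (L : ℤ) ∧ True},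
            ENNReal.ofReal (criticalFugacity ^ (l.1.map List.length).sum)) ≤
        ∑' l : {l : List (List Step) // (∀ w ∈ l, IsIrrBridge w) ∧ (l.map xEnd).sum = (L : ℤ) ∧
            ∀ w ∈ l, (b : ℤ) * xEnd w ≤ (W : ℤ)},
          ENNReal.ofReal (criticalFugacity ^ (l.1.map List.length).sum)) ∧
    (∃ C : ℝ, 0 < C ∧ ∀ K n : ℕ, 1 ≤ K →
      (K : ℝ≥0∞) ^ 2 *
          (∑' l : {l : List (List Step) // (∀ w ∈ l, IsIrrBridge w) ∧ (l.map xEnd).sum = (n : ℤ) ∧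
              ∀ w ∈ l, (K : ℤ) * xEnd w < (n : ℤ)},
            ENNReal.ofReal (criticalFugacity ^ (l.1.map List.length).sum)) ≤
        ENNReal.ofReal C *
          ∑' l : {l : List (List Step) // (∀ w ∈ l, IsIrrBridge w) ∧ (l.map xEnd).sum = (n : ℤ) ∧ True},
            ENNReal.ofReal (criticalFugacity ^ (l.1.map List.length).sum)) ∧
    (∀ A D : ℕ, 1 ≤ A → 1 ≤ D → ∃ s₀ : ℕ, ∃ c : ℝ, 0 < c ∧ ∀ s : ℕ, s₀ ≤ s → ∀ h : ℤ, |h| ≤ ((A * s : ℕ) : ℤ) →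
      c / s * (∑' w : {w : List Step // IsIrrBridge w},
          {w : {w : List Step // IsIrrBridge w} | xEnd w.1 = s}.indicator
            (fun w => criticalFugacity ^ w.1.length) w) ≤
        ∑' w : {w : List Step // IsIrrBridge w},
          {w : {w : List Step // IsIrrBridge w} | xEnd w.1 = s ∧ wEnd w.1 1 = h ∧
              ∀ i, (D : ℤ) * min h 0 - (s : ℤ) ≤ (D : ℤ) * traj w.1 i 1 ∧
                (D : ℤ) * traj w.1 i 1 ≤ (D : ℤ) * max h 0 + (s : ℤ)}.indicator
            (fun w => criticalFugacity ^ w.1.length) w)) →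
    (∀ α : ℕ, 1 ≤ α → ∃ c : ℝ, 0 < c ∧ ∀ (L W V : ℕ) (y₀ y₁ : ℤ), 1 ≤ W → W ≤ V → L ≤ α * W →
      W ≤ α * (L + 1) → 2 * |y₀| ≤ (W : ℤ) → 2 * |y₁| ≤ (W : ℤ) → ∀ N : ℕ, ∃ N' : ℕ,
        c * (∑ n ∈ Finset.range (N + 1), ∑ _ω ∈ (Zd.sawFun 2 n ![(L : ℤ), y₁ - y₀]).filter
            (fun ω => ∀ i ≤ n, (0 : ℤ) ≤ ω i 0 ∧ ω i 0 ≤ (L : ℤ) ∧ |y₀ + ω i 1| ≤ (V : ℤ)), criticalFugacity ^ n) ≤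
          (∑ n ∈ Finset.range (N' + 1), ∑ _ω ∈ (Zd.sawFun 2 n ![(L : ℤ), y₁ - y₀]).filter
            (fun ω => ∀ i ≤ n, (0 : ℤ) ≤ ω i 0 ∧ ω i 0 ≤ (L : ℤ) ∧ |y₀ + ω i 1| ≤ (W : ℤ)), criticalFugacity ^ n)) :=
  fun hP hR =>
    stub_pinnedAssembly (stub_pinnedDenominator hP.2 hR.2.1)
      (stub_pinnedNumerator (stub_unpinnedSlabTube (stub_extentSecondMoment_of_expTail hP.1) hR.1) hR.2.2 hR.2.1)

end Summit.CriticalPhenomena.SAWScalingLimit.Theorems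

end
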